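import Summits.Ventures.HSemireg.WedgeHankelRecurrenceGundelfinger
import Summits.Ventures.HSemireg.WedgeHankelRecurrenceJacobiReal

/-!
# Venture HSemireg — HERMITE'S THEOREM BY DETERMINANTS WITH ISOLATED VANISHING MINORS: N139's root counts `TaQ(Q, P) = Σ_{k ≤ t} sign(Δ_{k−1}Δ_k)`, `#real roots = P − V`, `#pairs = V` survive
# when some Hankel determinants `Δ_k = det H_k(Q·P′/P)` VANISH, provided `Δ_t ≠ 0` and no two consecutive `Δ_k` vanish — by Gundelfinger's rule (N143): **`Σ_{x ∈ roots_ℝ P} sign Q(x) =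
# Σ_{k ≤ t} sign(Δ_{k−1}Δ_k)`** (a zero contributes `0` to the sum), **`#distinct real roots = P − V`**, **`#pairs of non-real roots = V + Z`** with `Z` the number of vanishing `Δ_k` (`k < t`)

HONEST FRAMING. Part of the Lean index of the computation cell `pub-hsemireg` (seat p10 gen 35, Sunday typer «UNIFORM-IN-n»).
LINEAR ALGEBRA OF HANKEL (catalecticant) MATRICES AND REAL ∕ COMPLEX POLYNOMIALS ONLY (Mathlib's `sigPos` ∕ `sigNeg`, `Polynomial.roots` ∕ `aroots ℂ`, PROVED Literature `tarskiQuery`): no variety, no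
cohomology theory, no sheaf, no Ext group and no semiregularity map is constructed here; nothing here says that HC / HC_CM / HC_AV holds; no Literature fact (unproved `Prop`) is declared or used.
Custodian versions as in `WedgeHankelSiegelIdeal` (1/3).
SOURCE OF THE ARGUMENT (classical, cited not used): C. Hermite (1856) ∕ C. G. J. Jacobi (1857) for the determinant count; S. Gundelfinger (1881) for isolated zeros (Gantmacher, *The Theory of Matrices* I,
Ch. X §3–§4; II, Ch. XV §11 for the Hankel ∕ root-counting reading); Basu–Pollack–Roy (2006) Rem. 4.59 ∕ §9.1 (signature of Hermite's form from principal minors).  This file is N139 with N138's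
hypothesis «all `Δ_k ≠ 0`» weakened to N143's «`Δ_t ≠ 0`, no two consecutive zeros».
DEDUP DISCLOSURE (`rg` of the whole tree + Mathlib, 2026-09-01): N139 (`WedgeHankelRecurrenceJacobiReal`) has exactly these statements under the STRONGER hypothesis `∀ k ≤ t, Δ_k ≠ 0`; N143
(`WedgeHankelRecurrenceGundelfinger`) has the abstract rule and its Hankel count but no polynomial ∕ root reading; nothing else in the tree counts roots by leading minors.  The statements here have a
different hypothesis list from N139's (the gate compares elaborated types including hypotheses), and new names.  6 names: 0 hits tree-wide.

WHAT IS IN THE TREE (or staged ahead of this file).  N143: **`sigPos_sub_sigNeg_eq_sum_sign_of_isolated`** (`sigPos − sigNeg = Σ_{k<N} sign(D_k D_{k+1})` for a symmetric table with `D_N ≠ 0` and isolated zeros),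
**`sigPos_sigNeg_hankelSq_of_isolated`** (the two counts for `H_t(q)`); N138 `hankelSq_eq_of`; N129 `sigPos_sub_sigNeg_hankelSq_dualSeq_mul_derivative_real` (`= Σ_{x} sign Q(x)`), `tarskiQuery_eq_sum_sign`;
N133 `sigNeg_hankelSq_dualSeq_derivative_real_eq_card_upper` (`sigNeg H_t(P′/P) = #pairs`).  Mathlib: `Matrix.det_fin_zero`, `sign_one`.
THIS FILE (namespace `Summit.Ventures.HSemireg.Wedge.HankelOuter` continued; CHAINED on N143, PLAIN on N139 (hence N138, N133, N129); 0 definitions; `Δ_{k−1}Δ_k` is written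
`det (of (i j : Fin k) ↦ q_{i+j}) * det (hankelSq ℝ k q)` as in N139):
* §748 `sigPos_sub_sigNeg_hankelSq_eq_sum_sign_of_isolated` (the Hankel form of N143's signature formula, any linearly ordered field), **`sum_sign_eval_roots_eq_sum_sign_det_of_isolated`** (HERMITE with
  isolated zero minors: `Σ_{x ∈ roots_ℝ P} sign Q(x) = Σ_{k ≤ t} sign(Δ_{k−1}Δ_k)`), `tarskiQuery_eq_sum_sign_det_of_isolated`.
* §749 (`Q = 1`) **`card_roots_toFinset_eq_sum_sign_det_of_isolated`** (#distinct real roots = permanences − variations, zeros skipped), **`card_upper_roots_eq_card_filter_add_of_isolated`** (#pairs of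
  non-real roots = #variations + #vanishing `Δ_k`), `splits_iff_of_isolated` (real-rooted ⟺ no variation AND no vanishing minor).
CAVEATS.  `R = ℝ`, `C = ℂ` as in N128 ∕ N139; `P` MONIC, `deg P ≤ t + 1` with `Δ_t ≠ 0` (so in fact `t + 1` = the number of distinct complex roots not killed by `Q`); two CONSECUTIVE vanishing minors
(Frobenius' rule) remain excluded.
Nothing Ext-side.  New names only.
-/

open Module Polynomial
open scoped Matrix Polynomial

namespace Summit.Ventures.HSemireg.Wedge.HankelOuter

open Summit.Ventures.HSemireg.Wedge Summit.Ventures.HSemireg.Wedge.Hankel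

/-! ## §748. Hermite's theorem by determinants with isolated vanishing minors -/

section Ordered

variable {K : Type*} [Field K] [LinearOrder K] [IsStrictOrderedRing K]

/-- **`sigPos H_t(q) − sigNeg H_t(q) = Σ_{k ≤ t} sign(Δ_{k−1} Δ_k)`** for `Δ_t ≠ 0` and no two consecutive `Δ_k`, `Δ_{k+1}` zero (`Δ_{−1} = 1`; N143's formula read for Hankel forms). [this file, §748] -/
theorem sigPos_sub_sigNeg_hankelSq_eq_sum_sign_of_isolated (t : ℕ) (q : ℕ → K) (ht : (hankelSq K t q).det ≠ 0) (hiso : ∀ k, k < t → (hankelSq K k q).det = 0 → (hankelSq K (k + 1) q).det ≠ 0) :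
    (sigPos (hankelSq K t q).toQuadraticForm' : ℤ) - sigNeg (hankelSq K t q).toQuadraticForm'
      = ∑ k ∈ Finset.range (t + 1), (SignType.sign ((Matrix.of fun i j : Fin k => q ((i : ℕ) + (j : ℕ))).det * (hankelSq K k q).det) : ℤ) := by
  have hiso' : ∀ k, k < t + 1 → (Matrix.of fun i j : Fin k => q ((i : ℕ) + (j : ℕ))).det = 0 → (Matrix.of fun i j : Fin (k + 1) => q ((i : ℕ) + (j : ℕ))).det ≠ 0 := by
    intro k hk h0
    rcases k with _ | k
    · rw [Matrix.det_fin_zero] at h0; exact absurd h0 one_ne_zero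
    · exact hiso k (by omega) h0
  exact sigPos_sub_sigNeg_eq_sum_sign_of_isolated (S := fun i j => q (i + j)) (fun i j => by rw [add_comm]) (t + 1) ht hiso'

end Ordered

/-- **HERMITE BY DETERMINANTS WITH ISOLATED VANISHING MINORS: for `P` monic real of degree `≤ t + 1`, any `Q`, `Δ_k = det H_k(Q·P′/P)` with `Δ_t ≠ 0` and no two consecutive `Δ_k` (`k ≤ t`) vanishing,
`Σ_{x ∈ roots_ℝ(P)} sign Q(x) = Σ_{k ≤ t} sign(Δ_{k−1} Δ_k)`** (N129 `Sign = TaQ` + N143 Gundelfinger; N139 needed all `Δ_k ≠ 0`). [this file, §748] -/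
theorem sum_sign_eval_roots_eq_sum_sign_det_of_isolated {t : ℕ} {P : ℝ[X]} (hP : P.Monic) (hPd : P.natDegree ≤ t + 1) (Q : ℝ[X]) (ht : (hankelSq ℝ t (dualSeq ℝ P (Q * derivative P))).det ≠ 0)
    (hiso : ∀ k, k < t → (hankelSq ℝ k (dualSeq ℝ P (Q * derivative P))).det = 0 → (hankelSq ℝ (k + 1) (dualSeq ℝ P (Q * derivative P))).det ≠ 0) :
    ∑ x ∈ P.roots.toFinset, (SignType.sign (Q.eval x) : ℤ)
      = ∑ k ∈ Finset.range (t + 1), (SignType.sign ((Matrix.of fun i j : Fin k => dualSeq ℝ P (Q * derivative P) ((i : ℕ) + (j : ℕ))).det * (hankelSq ℝ k (dualSeq ℝ P (Q * derivative P))).det) : ℤ) := by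
  rw [← sigPos_sub_sigNeg_hankelSq_dualSeq_mul_derivative_real hP hPd Q, sigPos_sub_sigNeg_hankelSq_eq_sum_sign_of_isolated t _ ht hiso]

/-- **… and with the tree's Sturm–Tarski count: `TaQ(Q, P; a, b) = Σ_{k ≤ t} sign(Δ_{k−1} Δ_k)`** when all real roots of `P` lie in `(a, b)` (Literature `tarskiQuery`, via N129). [this file, §748] -/
theorem tarskiQuery_eq_sum_sign_det_of_isolated {t : ℕ} {P : ℝ[X]} (hP : P.Monic) (hPd : P.natDegree ≤ t + 1) (Q : ℝ[X]) {a b : ℝ} (hab : ∀ x ∈ P.roots, a < x ∧ x < b)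
    (ht : (hankelSq ℝ t (dualSeq ℝ P (Q * derivative P))).det ≠ 0) (hiso : ∀ k, k < t → (hankelSq ℝ k (dualSeq ℝ P (Q * derivative P))).det = 0 → (hankelSq ℝ (k + 1) (dualSeq ℝ P (Q * derivative P))).det ≠ 0) :
    Literature.Algebra.Polynomial.tarskiQuery Q P a b
      = ∑ k ∈ Finset.range (t + 1), (SignType.sign ((Matrix.of fun i j : Fin k => dualSeq ℝ P (Q * derivative P) ((i : ℕ) + (j : ℕ))).det * (hankelSq ℝ k (dualSeq ℝ P (Q * derivative P))).det) : ℤ) := by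
  rw [tarskiQuery_eq_sum_sign P Q hab, sum_sign_eval_roots_eq_sum_sign_det_of_isolated hP hPd Q ht hiso]

/-! ## §749. `Q = 1`: distinct real roots and pairs of non-real roots with isolated vanishing minors -/

/-- **The NUMBER OF DISTINCT REAL ROOTS of a monic real `P` (`deg P ≤ t + 1`) is `Σ_{k ≤ t} sign(Δ_{k−1}Δ_k)` = permanences − variations of `1, Δ_0, …, Δ_t` with zeros SKIPPED**, `Δ_k = det H_k(P′/P)`,
as soon as `Δ_t ≠ 0` and no two consecutive `Δ_k` vanish. [this file, §749] -/
theorem card_roots_toFinset_eq_sum_sign_det_of_isolated {t : ℕ} {P : ℝ[X]} (hP : P.Monic) (hPd : P.natDegree ≤ t + 1) (ht : (hankelSq ℝ t (dualSeq ℝ P (derivative P))).det ≠ 0)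
    (hiso : ∀ k, k < t → (hankelSq ℝ k (dualSeq ℝ P (derivative P))).det = 0 → (hankelSq ℝ (k + 1) (dualSeq ℝ P (derivative P))).det ≠ 0) :
    (P.roots.toFinset.card : ℤ) = ∑ k ∈ Finset.range (t + 1), (SignType.sign ((Matrix.of fun i j : Fin k => dualSeq ℝ P (derivative P) ((i : ℕ) + (j : ℕ))).det * (hankelSq ℝ k (dualSeq ℝ P (derivative P))).det) : ℤ) := by
  have h := sum_sign_eval_roots_eq_sum_sign_det_of_isolated hP hPd 1 (by simpa only [one_mul] using ht) (by simpa only [one_mul] using hiso)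
  simp only [one_mul, eval_one, sign_one, SignType.coe_one, Finset.sum_const, nsmul_eq_mul, mul_one] at h
  rw [← h]

/-- **The NUMBER OF PAIRS OF NON-REAL ROOTS is `#variations + #vanishing minors`: `#{z : im z > 0, P(z) = 0} = #{k ≤ t | Δ_{k−1}Δ_k < 0} + #{k ≤ t | Δ_k = 0}`** (`Δ_t ≠ 0`, isolated zeros; N133
`sigNeg = #pairs` + N143). [this file, §749] -/
theorem card_upper_roots_eq_card_filter_add_of_isolated {t : ℕ} {P : ℝ[X]} (hP : P.Monic) (hPd : P.natDegree ≤ t + 1) (ht : (hankelSq ℝ t (dualSeq ℝ P (derivative P))).det ≠ 0)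
    (hiso : ∀ k, k < t → (hankelSq ℝ k (dualSeq ℝ P (derivative P))).det = 0 → (hankelSq ℝ (k + 1) (dualSeq ℝ P (derivative P))).det ≠ 0) :
    ((P.aroots ℂ).toFinset.filter fun z => 0 < z.im).card
      = ((Finset.range (t + 1)).filter fun k => (Matrix.of fun i j : Fin k => dualSeq ℝ P (derivative P) ((i : ℕ) + (j : ℕ))).det * (hankelSq ℝ k (dualSeq ℝ P (derivative P))).det < 0).card
        + ((Finset.range (t + 1)).filter fun k => (hankelSq ℝ k (dualSeq ℝ P (derivative P))).det = 0).card := by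
  rw [← sigNeg_hankelSq_dualSeq_derivative_real_eq_card_upper hP hPd, (sigPos_sigNeg_hankelSq_of_isolated t _ ht hiso).2]

/-- **REAL-ROOTEDNESS: `P` splits over `ℝ` iff there is NO variation and NO vanishing minor among `Δ_0, …, Δ_t`** (under `Δ_t ≠ 0` and isolated zeros: an isolated zero always costs a pair of
non-real roots). [this file, §749] -/
theorem splits_iff_of_isolated {t : ℕ} {P : ℝ[X]} (hP : P.Monic) (hPd : P.natDegree ≤ t + 1) (ht : (hankelSq ℝ t (dualSeq ℝ P (derivative P))).det ≠ 0)
    (hiso : ∀ k, k < t → (hankelSq ℝ k (dualSeq ℝ P (derivative P))).det = 0 → (hankelSq ℝ (k + 1) (dualSeq ℝ P (derivative P))).det ≠ 0) :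
    P.Splits ↔ (∀ k, k ≤ t → ¬ (Matrix.of fun i j : Fin k => dualSeq ℝ P (derivative P) ((i : ℕ) + (j : ℕ))).det * (hankelSq ℝ k (dualSeq ℝ P (derivative P))).det < 0)
      ∧ ∀ k, k ≤ t → (hankelSq ℝ k (dualSeq ℝ P (derivative P))).det ≠ 0 := by
  rw [splits_iff_card_upper_eq_zero P, card_upper_roots_eq_card_filter_add_of_isolated hP hPd ht hiso, Nat.add_eq_zero_iff, Finset.card_eq_zero, Finset.card_eq_zero, Finset.filter_eq_empty_iff,
    Finset.filter_eq_empty_iff]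
  constructor
  · rintro ⟨h1, h2⟩
    exact ⟨fun k hk => h1 (Finset.mem_range.2 (Nat.lt_succ_of_le hk)), fun k hk => h2 (Finset.mem_range.2 (Nat.lt_succ_of_le hk))⟩
  · rintro ⟨h1, h2⟩
    exact ⟨fun k hk => h1 k (Nat.le_of_lt_succ (Finset.mem_range.1 hk)), fun k hk => h2 k (Nat.le_of_lt_succ (Finset.mem_range.1 hk))⟩

end Summit.Ventures.HSemireg.Wedge.HankelOuter
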